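import Summits.QuantumFields.BalabanUV.T4Continuum.Support.NE7ConvOneStepWeightedClass
import Summits.QuantumFields.BalabanUV.T4Continuum.Support.AveragingDeficitMultiLevelBridge
import HarnessLib

/-!
# NE7ConvOneStepTangent — ONE-STEP ⇐ CRIT-ONE-STEP ∧ REP_w with CRITICALITY IN THE TANGENT CURRENCY (the currency of F18 `NE7CritClosed` and of the slice
# `T_♮(U♯)`): the class END and the `d = 4`, `L = 2`, SU(2) ∕ SU(3) ENDs, so that F18's `critOneStep_tan_of_continuity` feeds CONV directly

Cell `pub-balaban`, rung (B)+1 sub-cell t4, lineage `b2b-balaban-t4-ne7-p1`, generation 67 (CRUX PROVER NE7 #1); hunt (h11), memo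
`t4/b2b-balaban-t4-ne7-p1-g67/HUNT-H11-NORMAL-CURRENCY.md` §3.  File F19 = F15 `NE7ConvOneStepWeightedClass` with the criticality hypothesis stated on the
TANGENT SPACE `T(U♯) = {φ skew, (N·L^{k+1})-periodic : TangentIter L k U♯ φ}` instead of `ker levelQ'` — the slice `frameFreeBlockLandauW L N (k+1) U♯` of
(P♮)_W lies in `T(U♯)` BY DEFINITION (`NE3FrameFreeSliceW`), so no `LevelSmall` hypothesis and no `ker`-adapter (F10) is needed for CONV.

WHAT ([folklore] composition; 0 def, 0 sorry; four theorems).  §1 `isMinimiser_of_tanCritical_repW_class` (F9 `isMinimiser_of_critical_rep_weighted` with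
`T_♮ ⊆ T`); §2 `oneStep_of_tanCritical_repW_class` (the `hstep` binder of `NE7InteriorInduction.interior_exists_all_levels`); §3
`oneStep_SU2_of_tanCritical_repW` ∕ `oneStep_SU3_of_tanCritical_repW` (`d = 4`, `L = 2`, `card n = 2 ∕ 3`, `0 < ε ≤ 10⁻⁵³`; (P♮)_W by
`classSlicePoincare_SU2'` ∕ `classSlicePoincare_SU3`).  JOINT READING WITH F18: for the programme's case, ONE-STEP ⇐ [kernel] (PATH ∧ OPEN) ∧ REP_w —
PATH ∧ OPEN give the tangent-critical small admissible `U♯` at every level (`critOneStep_tan_of_continuity`), REP_w represents every competitor over it.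
HONEST FRAMING (page 1).  Composition over HYPOTHESES (CRIT in the tangent currency, REP_w = B8 Thm 2 TYPE chord + smooth-lift normal sizes); NOT ONE-STEP,
NOT NE7; spine 0∕9; finite T⁴ rung (B)+1 — NOT infinite volume, NOT mass gap, NOT Clay.  Continuum YM on T⁴ ⇐ BetaPertH ∧ nine spine estimates (0/9
proved); BetaPertH ⇐ (D1) ∧ (D4) ∧ CAP+tail; G-an2-4 gates asym, D1 and NE2/3/4.
-/

set_option autoImplicit false

open scoped BigOperators Matrix.Norms.L2Operator
open NormedSpace Finset Set

namespace Summit.QuantumFields.BalabanUV.T4Continuum.NE7ConvOneStepTangent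

open Literature.MathematicalPhysics.QuantumFieldTheory.Balaban1983to89
open B7Prop1Explicit B7Prop2Explicit MatrixLog UnitaryModel
open T4AveragingDeficitWall (IsUnitaryCfg IsSkewDir SmallField fineAction vary curl curlSq dirSq)
open T4AveragingDeficitWallBoundary (IsPeriodicCfg periodBox)
open AveragingDeficitPeriodicCounting (IsPeriodicDir)
open AveragingDeficitTorusChart (TDir extDir)
open AveragingDeficitMultiLevelPrep (tower LevelSmall levelQ' TangentIter)
open AveragingDeficitMultiLevelBridge (tower_eq)
open MinimalActionLevels (levelAction perWin)
open MinimalActionSandwich (IsMinimiser admissible)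
open MinimalActionRate (sfClass)
open NE3HessForm (dAction)
open NE3SlicePoincareShape (SlicePoincare slicePoincare_mono)
open NE3FrameFreeSliceW (frameFreeBlockLandauW)
open NE3EnergyWeightedShapes (energyNormW)
open NE3SlicePoincareBudgetLine (CPLine)
open NE3ClassRadiusFamily (classSlicePoincare_SU2' CPLine_nonneg CPLine_nonneg_d4_L2)
open NE7ConvOneStepWeighted (isMinimiser_of_critical_rep_weighted)
open NE7ConvOneStepSU3 (classSlicePoincare_SU3)

noncomputable section

variable {d : ℕ} {n : Type*} [Fintype n] [DecidableEq n]

/-! ## §1 CONV-ONE-STEP over the class, criticality on the tangent space, REP in the weighted currency -/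

/-- **CONV-ONE-STEP ON THE CLASS FROM CRITICALITY ON THE TANGENT SPACE AND REP WITH WEIGHTED NORMAL LETTERS** (F9 `isMinimiser_of_critical_rep_weighted`
at `a = ε(L^{k+1})^{−2}`, `T = T_♮(U♯) ⊆ T(U♯)`, `C = CP`; `L, N ≥ 1`, `ε ≥ 0`, `0 < CP`).  See the module docstring, §1. [folklore] -/
theorem isMinimiser_of_tanCritical_repW_class [Nonempty n] {L N k : ℕ} [NeZero L] [NeZero N] (hL : 1 ≤ L) (hN : 1 ≤ N) {ε CP : ℝ}
    (hε : 0 ≤ ε) (hCP : 0 < CP)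
    (hP : ∀ (j : ℕ) (W : Site d → Fin d → (Matrix n n ℂ)ˣ), W ∈ sfClass d L N ε (j + 1) →
      SlicePoincare L (j + 1) W (frameFreeBlockLandauW L N (j + 1) W) CP (periodBox (d := d) (N * L ^ (j + 1))))
    {V Us : Site d → Fin d → (Matrix n n ℂ)ˣ} (hmem : Us ∈ admissible (sfClass d L N ε) L (k + 1) V)
    (hcritT : ∀ φ : Site d → Fin d → Matrix n n ℂ, IsSkewDir φ → IsPeriodicDir φ ((N * L ^ (k + 1) : ℕ) : ℤ) → TangentIter L k Us φ →
      dAction Us φ (perWin d (N * L ^ (k + 1))) = 0)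
    (hrep : ∀ U' ∈ admissible (sfClass d L N ε) L (k + 1) V, ∃ (X XT XN : Site d → Fin d → Matrix n n ℂ) (α ν κ₁ : ℝ),
      IsSkewDir X ∧ IsPeriodicDir X ((N * L ^ (k + 1) : ℕ) : ℤ) ∧ 0 ≤ α ∧ (∀ x μ, ‖X x μ‖ ≤ α) ∧
      levelAction d L N (k + 1) (vary Us X 1) ≤ levelAction d L N (k + 1) U' ∧
      SmallField (vary Us X 1) (ε / ((L : ℝ) ^ (k + 1)) ^ 2) ∧
      X = XT + XN ∧ XT ∈ frameFreeBlockLandauW (d := d) (n := n) L N (k + 1) Us ∧ IsSkewDir XN ∧ 0 ≤ ν ∧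
      energyNormW L (k + 1) Us XN (periodBox (d := d) (N * L ^ (k + 1)))
        ≤ ν * energyNormW L (k + 1) Us X (periodBox (d := d) (N * L ^ (k + 1))) ∧
      ε / ((L : ℝ) ^ (k + 1)) ^ 2 * (∑ p ∈ perWin d (N * L ^ (k + 1)), ‖curl Us XN p‖)
        ≤ κ₁ * energyNormW L (k + 1) Us X (periodBox (d := d) (N * L ^ (k + 1))) ^ 2 ∧
      2 * κ₁ ≤ ((((1 / 2 - ν ^ 2) / (2 * (1 + CP)) - ν ^ 2) / 2
          - 576 * d * (Real.exp α - 1) ^ 2 * ((L : ℝ) ^ (k + 1)) ^ 2) / (Fintype.card n : ℝ)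
          - 28 * d * (ε / ((L : ℝ) ^ (k + 1)) ^ 2 + 7 * α ^ 2) * ((L : ℝ) ^ (k + 1)) ^ 2)) :
    IsMinimiser d (sfClass d L N ε) L N (k + 1) V Us := by
  have ha : 0 ≤ ε / ((L : ℝ) ^ (k + 1)) ^ 2 := by positivity
  have hcrit : ∀ Y ∈ frameFreeBlockLandauW (d := d) (n := n) L N (k + 1) Us, dAction Us Y (perWin d (N * L ^ (k + 1))) = 0 := by
    intro Y hY
    obtain ⟨hYs, hYP, hYT, -, -⟩ := hY
    have hYP' : IsPeriodicDir Y ((N * L ^ (k + 1) : ℕ) : ℤ) := by rw [← tower_eq L N (k + 1)]; exact hYP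
    have hYT' : TangentIter L k Us Y := by simpa using hYT
    exact hcritT Y hYs hYP' hYT'
  exact isMinimiser_of_critical_rep_weighted hL hN hmem hmem.1.1 ha hmem.1.2.2 hCP (hP k Us hmem.1) hcrit hrep

/-! ## §2 ONE-STEP from «CRIT-ONE-STEP on the tangent space + REP (weighted)» at every level -/

/-- **ONE-STEP FROM «CRIT-ONE-STEP ON THE TANGENT SPACE + REP WITH WEIGHTED NORMAL LETTERS» GIVEN (P♮)_W** (the `hstep`
binder of `NE7InteriorInduction.interior_exists_all_levels`).  See the module docstring, §2. [folklore] -/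
theorem oneStep_of_tanCritical_repW_class [Nonempty n] {L N : ℕ} [NeZero L] [NeZero N] (hL : 1 ≤ L) (hN : 1 ≤ N) {ε δ CP : ℝ}
    (hε : 0 ≤ ε) (hCP : 0 < CP)
    (hP : ∀ (j : ℕ) (W : Site d → Fin d → (Matrix n n ℂ)ˣ), W ∈ sfClass d L N ε (j + 1) →
      SlicePoincare L (j + 1) W (frameFreeBlockLandauW L N (j + 1) W) CP (periodBox (d := d) (N * L ^ (j + 1))))
    {V : Site d → Fin d → (Matrix n n ℂ)ˣ}
    (hcrit : ∀ (k : ℕ) (U₀ : Site d → Fin d → (Matrix n n ℂ)ˣ), U₀ ∈ admissible (sfClass d L N ε) L (k + 1) V →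
      SmallField U₀ (δ / ((L : ℝ) ^ k) ^ 2) →
      ∃ Us : Site d → Fin d → (Matrix n n ℂ)ˣ, Us ∈ admissible (sfClass d L N ε) L (k + 1) V ∧ SmallField Us (δ / ((L : ℝ) ^ (k + 1)) ^ 2) ∧
        (∀ φ : Site d → Fin d → Matrix n n ℂ, IsSkewDir φ → IsPeriodicDir φ ((N * L ^ (k + 1) : ℕ) : ℤ) → TangentIter L k Us φ →
          dAction Us φ (perWin d (N * L ^ (k + 1))) = 0) ∧
        ∀ U' ∈ admissible (sfClass d L N ε) L (k + 1) V, ∃ (X XT XN : Site d → Fin d → Matrix n n ℂ) (α ν κ₁ : ℝ),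
          IsSkewDir X ∧ IsPeriodicDir X ((N * L ^ (k + 1) : ℕ) : ℤ) ∧ 0 ≤ α ∧ (∀ x μ, ‖X x μ‖ ≤ α) ∧
          levelAction d L N (k + 1) (vary Us X 1) ≤ levelAction d L N (k + 1) U' ∧
          SmallField (vary Us X 1) (ε / ((L : ℝ) ^ (k + 1)) ^ 2) ∧
          X = XT + XN ∧ XT ∈ frameFreeBlockLandauW (d := d) (n := n) L N (k + 1) Us ∧ IsSkewDir XN ∧ 0 ≤ ν ∧
          energyNormW L (k + 1) Us XN (periodBox (d := d) (N * L ^ (k + 1)))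
            ≤ ν * energyNormW L (k + 1) Us X (periodBox (d := d) (N * L ^ (k + 1))) ∧
          ε / ((L : ℝ) ^ (k + 1)) ^ 2 * (∑ p ∈ perWin d (N * L ^ (k + 1)), ‖curl Us XN p‖)
            ≤ κ₁ * energyNormW L (k + 1) Us X (periodBox (d := d) (N * L ^ (k + 1))) ^ 2 ∧
          2 * κ₁ ≤ ((((1 / 2 - ν ^ 2) / (2 * (1 + CP)) - ν ^ 2) / 2
              - 576 * d * (Real.exp α - 1) ^ 2 * ((L : ℝ) ^ (k + 1)) ^ 2) / (Fintype.card n : ℝ)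
              - 28 * d * (ε / ((L : ℝ) ^ (k + 1)) ^ 2 + 7 * α ^ 2) * ((L : ℝ) ^ (k + 1)) ^ 2)) :
    ∀ (k : ℕ) (U₀ : Site d → Fin d → (Matrix n n ℂ)ˣ), U₀ ∈ admissible (sfClass d L N ε) L (k + 1) V →
      SmallField U₀ (δ / ((L : ℝ) ^ k) ^ 2) →
      ∃ U, IsMinimiser d (sfClass d L N ε) L N (k + 1) V U ∧ SmallField U (δ / ((L : ℝ) ^ (k + 1)) ^ 2) := by
  intro k U₀ hU₀ hU₀a
  obtain ⟨Us, hmem, hUsδ, hcr, hrep⟩ := hcrit k U₀ hU₀ hU₀a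
  exact ⟨Us, isMinimiser_of_tanCritical_repW_class hL hN hε hCP hP hmem hcr hrep, hUsδ⟩

/-! ## §3 The programme's case `d = 4`, `L = 2`: SU(2) ∕ U(2) and SU(3) ∕ U(3) -/

/-- **ONE-STEP AT `d = 4`, `L = 2`, SU(2)∕U(2) (`card n = 2`), `0 < ε ≤ 10⁻⁵³`, FROM CRIT-ONE-STEP ON THE TANGENT SPACE AND REP WITH WEIGHTED NORMAL LETTERS
ONLY** — (P♮)_W by `NE3ClassRadiusFamily.classSlicePoincare_SU2'`, constant of record `CP = CPLine 4 2 2 10⁻¹⁷ 10⁻⁵³ + 1`.  See the module docstring, §3. [folklore] -/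
theorem oneStep_SU2_of_tanCritical_repW [Nonempty n] (hn : Fintype.card n = 2) {N : ℕ} [NeZero N] (hN : 1 ≤ N) {ε δ : ℝ} (hε : 0 < ε)
    (hε' : ε ≤ 1 / 10 ^ 53) {V : Site 4 → Fin 4 → (Matrix n n ℂ)ˣ}
    (hcrit : ∀ (k : ℕ) (U₀ : Site 4 → Fin 4 → (Matrix n n ℂ)ˣ), U₀ ∈ admissible (sfClass 4 2 N ε) 2 (k + 1) V →
      SmallField U₀ (δ / (((2 : ℕ) : ℝ) ^ k) ^ 2) →
      ∃ Us : Site 4 → Fin 4 → (Matrix n n ℂ)ˣ, Us ∈ admissible (sfClass 4 2 N ε) 2 (k + 1) V ∧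
        SmallField Us (δ / (((2 : ℕ) : ℝ) ^ (k + 1)) ^ 2) ∧
        (∀ φ : Site 4 → Fin 4 → Matrix n n ℂ, IsSkewDir φ → IsPeriodicDir φ ((N * 2 ^ (k + 1) : ℕ) : ℤ) → TangentIter 2 k Us φ →
          dAction Us φ (perWin 4 (N * 2 ^ (k + 1))) = 0) ∧
        ∀ U' ∈ admissible (sfClass 4 2 N ε) 2 (k + 1) V, ∃ (X XT XN : Site 4 → Fin 4 → Matrix n n ℂ) (α ν κ₁ : ℝ),
          IsSkewDir X ∧ IsPeriodicDir X ((N * 2 ^ (k + 1) : ℕ) : ℤ) ∧ 0 ≤ α ∧ (∀ x μ, ‖X x μ‖ ≤ α) ∧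
          levelAction 4 2 N (k + 1) (vary Us X 1) ≤ levelAction 4 2 N (k + 1) U' ∧
          SmallField (vary Us X 1) (ε / (((2 : ℕ) : ℝ) ^ (k + 1)) ^ 2) ∧
          X = XT + XN ∧ XT ∈ frameFreeBlockLandauW (d := 4) (n := n) 2 N (k + 1) Us ∧ IsSkewDir XN ∧ 0 ≤ ν ∧
          energyNormW 2 (k + 1) Us XN (periodBox (d := 4) (N * 2 ^ (k + 1)))
            ≤ ν * energyNormW 2 (k + 1) Us X (periodBox (d := 4) (N * 2 ^ (k + 1))) ∧
          ε / (((2 : ℕ) : ℝ) ^ (k + 1)) ^ 2 * (∑ p ∈ perWin 4 (N * 2 ^ (k + 1)), ‖curl Us XN p‖)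
            ≤ κ₁ * energyNormW 2 (k + 1) Us X (periodBox (d := 4) (N * 2 ^ (k + 1))) ^ 2 ∧
          2 * κ₁ ≤ ((((1 / 2 - ν ^ 2) / (2 * (1 + (CPLine 4 2 2 (1 / 10 ^ 17) (1 / 10 ^ 53) + 1))) - ν ^ 2) / 2
              - 576 * (4 : ℕ) * (Real.exp α - 1) ^ 2 * ((((2 : ℕ) : ℝ)) ^ (k + 1)) ^ 2) / (Fintype.card n : ℝ)
              - 28 * (4 : ℕ) * (ε / (((2 : ℕ) : ℝ) ^ (k + 1)) ^ 2 + 7 * α ^ 2) * ((((2 : ℕ) : ℝ)) ^ (k + 1)) ^ 2)) :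
    ∀ (k : ℕ) (U₀ : Site 4 → Fin 4 → (Matrix n n ℂ)ˣ), U₀ ∈ admissible (sfClass 4 2 N ε) 2 (k + 1) V →
      SmallField U₀ (δ / (((2 : ℕ) : ℝ) ^ k) ^ 2) →
      ∃ U, IsMinimiser 4 (sfClass 4 2 N ε) 2 N (k + 1) V U ∧ SmallField U (δ / (((2 : ℕ) : ℝ) ^ (k + 1)) ^ 2) := by
  have hP0 := classSlicePoincare_SU2' (n := n) hn hN hε hε'
  have hCP : 0 < CPLine 4 2 2 (1 / 10 ^ 17) (1 / 10 ^ 53) + 1 := by linarith [CPLine_nonneg_d4_L2]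
  have hP : ∀ (j : ℕ) (W : Site 4 → Fin 4 → (Matrix n n ℂ)ˣ), W ∈ sfClass 4 2 N ε (j + 1) →
      SlicePoincare 2 (j + 1) W (frameFreeBlockLandauW 2 N (j + 1) W) (CPLine 4 2 2 (1 / 10 ^ 17) (1 / 10 ^ 53) + 1)
        (periodBox (d := 4) (N * 2 ^ (j + 1))) :=
    fun j W hW => slicePoincare_mono (hP0 j W hW) (by linarith)
  exact oneStep_of_tanCritical_repW_class (d := 4) (by norm_num) hN hε.le hCP hP hcrit

/-- **ONE-STEP AT `d = 4`, `L = 2`, SU(3)∕U(3) (`card n = 3`), `0 < ε ≤ 10⁻⁵³`, FROM CRIT-ONE-STEP ON THE TANGENT SPACE AND REP WITH WEIGHTED NORMAL LETTERS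
ONLY** — (P♮)_W by F13's `classSlicePoincare_SU3`, constant of record `CP = CPLine 4 2 3 10⁻¹⁷ 10⁻⁵³ + 1`.  See the module docstring, §3. [folklore] -/
theorem oneStep_SU3_of_tanCritical_repW [Nonempty n] (hn : Fintype.card n = 3) {N : ℕ} [NeZero N] (hN : 1 ≤ N) {ε δ : ℝ} (hε : 0 < ε)
    (hε' : ε ≤ 1 / 10 ^ 53) {V : Site 4 → Fin 4 → (Matrix n n ℂ)ˣ}
    (hcrit : ∀ (k : ℕ) (U₀ : Site 4 → Fin 4 → (Matrix n n ℂ)ˣ), U₀ ∈ admissible (sfClass 4 2 N ε) 2 (k + 1) V →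
      SmallField U₀ (δ / (((2 : ℕ) : ℝ) ^ k) ^ 2) →
      ∃ Us : Site 4 → Fin 4 → (Matrix n n ℂ)ˣ, Us ∈ admissible (sfClass 4 2 N ε) 2 (k + 1) V ∧
        SmallField Us (δ / (((2 : ℕ) : ℝ) ^ (k + 1)) ^ 2) ∧
        (∀ φ : Site 4 → Fin 4 → Matrix n n ℂ, IsSkewDir φ → IsPeriodicDir φ ((N * 2 ^ (k + 1) : ℕ) : ℤ) → TangentIter 2 k Us φ →
          dAction Us φ (perWin 4 (N * 2 ^ (k + 1))) = 0) ∧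
        ∀ U' ∈ admissible (sfClass 4 2 N ε) 2 (k + 1) V, ∃ (X XT XN : Site 4 → Fin 4 → Matrix n n ℂ) (α ν κ₁ : ℝ),
          IsSkewDir X ∧ IsPeriodicDir X ((N * 2 ^ (k + 1) : ℕ) : ℤ) ∧ 0 ≤ α ∧ (∀ x μ, ‖X x μ‖ ≤ α) ∧
          levelAction 4 2 N (k + 1) (vary Us X 1) ≤ levelAction 4 2 N (k + 1) U' ∧
          SmallField (vary Us X 1) (ε / (((2 : ℕ) : ℝ) ^ (k + 1)) ^ 2) ∧
          X = XT + XN ∧ XT ∈ frameFreeBlockLandauW (d := 4) (n := n) 2 N (k + 1) Us ∧ IsSkewDir XN ∧ 0 ≤ ν ∧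
          energyNormW 2 (k + 1) Us XN (periodBox (d := 4) (N * 2 ^ (k + 1)))
            ≤ ν * energyNormW 2 (k + 1) Us X (periodBox (d := 4) (N * 2 ^ (k + 1))) ∧
          ε / (((2 : ℕ) : ℝ) ^ (k + 1)) ^ 2 * (∑ p ∈ perWin 4 (N * 2 ^ (k + 1)), ‖curl Us XN p‖)
            ≤ κ₁ * energyNormW 2 (k + 1) Us X (periodBox (d := 4) (N * 2 ^ (k + 1))) ^ 2 ∧
          2 * κ₁ ≤ ((((1 / 2 - ν ^ 2) / (2 * (1 + (CPLine 4 2 3 (1 / 10 ^ 17) (1 / 10 ^ 53) + 1))) - ν ^ 2) / 2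
              - 576 * (4 : ℕ) * (Real.exp α - 1) ^ 2 * ((((2 : ℕ) : ℝ)) ^ (k + 1)) ^ 2) / (Fintype.card n : ℝ)
              - 28 * (4 : ℕ) * (ε / (((2 : ℕ) : ℝ) ^ (k + 1)) ^ 2 + 7 * α ^ 2) * ((((2 : ℕ) : ℝ)) ^ (k + 1)) ^ 2)) :
    ∀ (k : ℕ) (U₀ : Site 4 → Fin 4 → (Matrix n n ℂ)ˣ), U₀ ∈ admissible (sfClass 4 2 N ε) 2 (k + 1) V →
      SmallField U₀ (δ / (((2 : ℕ) : ℝ) ^ k) ^ 2) →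
      ∃ U, IsMinimiser 4 (sfClass 4 2 N ε) 2 N (k + 1) V U ∧ SmallField U (δ / (((2 : ℕ) : ℝ) ^ (k + 1)) ^ 2) := by
  have hP0 := classSlicePoincare_SU3 (n := n) hn hN hε hε'
  have hCP0 : 0 ≤ CPLine 4 2 3 (1 / 10 ^ 17) (1 / 10 ^ 53) := CPLine_nonneg (by norm_num) (by norm_num) (by norm_num) (by norm_num)
  have hCP : 0 < CPLine 4 2 3 (1 / 10 ^ 17) (1 / 10 ^ 53) + 1 := by linarith
  have hP : ∀ (j : ℕ) (W : Site 4 → Fin 4 → (Matrix n n ℂ)ˣ), W ∈ sfClass 4 2 N ε (j + 1) →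
      SlicePoincare 2 (j + 1) W (frameFreeBlockLandauW 2 N (j + 1) W) (CPLine 4 2 3 (1 / 10 ^ 17) (1 / 10 ^ 53) + 1)
        (periodBox (d := 4) (N * 2 ^ (j + 1))) :=
    fun j W hW => slicePoincare_mono (hP0 j W hW) (by linarith)
  exact oneStep_of_tanCritical_repW_class (d := 4) (by norm_num) hN hε.le hCP hP hcrit

end

end Summit.QuantumFields.BalabanUV.T4Continuum.NE7ConvOneStepTangent
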